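import Summits.AtomisticToContinuum.BoseEinsteinCondensation.Theses.BECInsertionVariance

/-!
# Route BECInsertionVariance — the frame `EntropyFrame`

`InsertionEntropyBound → TruncatedSwapJensen → GroundStateCondensate → BoseEinsteinCondensation`
(item stmt-AtomisticToContinuum-12070): pure bookkeeping. Fix `v`; take `ρ₀` the minimum of the two
density thresholds; for `0 < ρ < ρ₀` take `C` from the entropy bound and `C' = max C 0`; eventually in
`n`, truncated Jensen at `θ = 1/2` for `Φ = Ψ₀ = groundState v (n+1) L` gives
`swapPurity n Ψ₀ ≥ ½ e^{-C'}`, Penrose–Onsager (`succ_mul_swapPurity_le_maxOccupation`) gives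
`λ_max(γ_{Ψ₀}) ≥ (n+1) · ½ e^{-C'}`, `GroundStateCondensate` moves this to `condensateNumber`, and the
index shift `n + 1 ↦ N` yields `HasGroundStateBEC v ρ` with `c = ½ e^{-C'}`.
-/

noncomputable section

namespace Summit.AtomisticToContinuum.BoseEinsteinCondensation.Theorems

open MeasureTheory Filter
open scoped ENNReal
open Literature.MathematicalPhysics.QuantumManyBody.BoseGas
open Summit.AtomisticToContinuum.BoseEinsteinCondensation.Theses.BECInsertionVariance

/-- The complexified nonnegative ground state is (sub)normalised, `∫ |Ψ₀|² ≤ 1`, in both branches of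
`groundState` (`= 1` when a nonnegative ground state exists, `= 0` for the junk value). [folklore] -/
theorem lintegral_nnnorm_groundState_sq_le_one (v : ℝ → ℝ≥0∞) (N : ℕ) (L : ℝ) :
    ∫⁻ X, (‖(groundState v N L X : ℂ)‖₊ : ℝ≥0∞) ^ 2 ≤ 1 := by
  by_cases h : ∃ Ψ₀ : Config N → ℝ, (∀ X, 0 ≤ Ψ₀ X) ∧ IsGroundState v L (fun X => (Ψ₀ X : ℂ))
  · exact (isGroundState_groundState h).norm_eq.le
  · simp [groundState_of_not_exists h]

/-- The complexified ground state `X ↦ (Ψ₀ X : ℂ)` is measurable. [folklore] -/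
theorem measurable_groundState_complex (v : ℝ → ℝ≥0∞) (N : ℕ) (L : ℝ) :
    Measurable fun X => (groundState v N L X : ℂ) :=
  Complex.measurable_ofReal.comp (measurable_groundState v N L)

/-- **Frame of route BECInsertionVariance** (item stmt-AtomisticToContinuum-12070): the insertion
entropy bound, truncated swap Jensen and the identification of `λ_max(γ_{Ψ₀})` with the condensate
number together give ground-state BEC at all small densities, with condensate fraction
`≥ ½ e^{-max C 0}`. [cite: PenroseOnsager1956, §4 (5)–(7)] -/
theorem entropyFrame_proof :
    Summit.AtomisticToContinuum.BoseEinsteinCondensation.Theses.BECInsertionVariance.EntropyFrame := by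
  intro hA hJ hCnd v hv
  obtain ⟨ρ₁, hρ₁, h₁⟩ := hA v hv
  obtain ⟨ρ₂, hρ₂, h₂⟩ := hCnd v hv
  refine ⟨min ρ₁ ρ₂, lt_min hρ₁ hρ₂, fun ρ hρ hρlt => ?_⟩
  obtain ⟨C, hC⟩ := h₁ ρ hρ (hρlt.trans_le (min_le_left _ _))
  have hC₂ := h₂ ρ hρ (hρlt.trans_le (min_le_right _ _))
  set C' : ℝ := max C 0 with hC'
  set c : ℝ := 1 / 2 * Real.exp (-(C' / (2 * (1 / 2)))) with hc
  have hcpos : 0 < c := by positivity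
  refine ⟨c, hcpos, ?_⟩
  -- the statement along `N = n + 1`
  have key : ∀ᶠ n : ℕ in atTop, ENNReal.ofReal (c * ((n + 1 : ℕ) : ℝ)) ≤
      condensateNumber v (n + 1) (sideLength ρ (n + 1)) := by
    filter_upwards [hC, hC₂] with n hn hcn
    set Ψ₀ : Config (n + 1) → ℝ := groundState v (n + 1) (sideLength ρ (n + 1)) with hΨ₀
    obtain ⟨hmass, hent⟩ := hn
    have h12 : ENNReal.ofReal (1 / 2 : ℝ) = (1 / 2 : ℝ≥0∞) := by
      rw [ENNReal.ofReal_div_of_pos (by norm_num : (0 : ℝ) < 2)]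
      simp
    have hmass' := h12.symm ▸ hmass
    have hent' := hent.trans (ENNReal.ofReal_le_ofReal (le_max_left C 0))
    have hJ' := hJ n Ψ₀ (measurable_groundState _ _ _) (groundState_nonneg _ _ _)
      (lintegral_nnnorm_groundState_sq_le_one _ _ _) (1 / 2) C' one_half_pos (le_max_right C 0)
      hmass' hent'
    calc ENNReal.ofReal (c * ((n + 1 : ℕ) : ℝ))
        = ((n + 1 : ℕ) : ℝ≥0∞) * ENNReal.ofReal c := by
          rw [ENNReal.ofReal_mul hcpos.le, ENNReal.ofReal_natCast, mul_comm]
      _ ≤ ((n + 1 : ℕ) : ℝ≥0∞) * swapPurity n (fun X => (Ψ₀ X : ℂ)) := by gcongr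
      _ ≤ maxOccupation (n + 1) (fun X => (Ψ₀ X : ℂ)) :=
          succ_mul_swapPurity_le_maxOccupation (measurable_groundState_complex _ _ _)
            (lintegral_nnnorm_groundState_sq_le_one _ _ _)
      _ ≤ condensateNumber v (n + 1) (sideLength ρ (n + 1)) := hcn
  -- index shift `n + 1 ↦ N`
  rw [Filter.eventually_atTop] at key ⊢
  obtain ⟨a, ha⟩ := key
  refine ⟨a + 1, fun N hN => ?_⟩
  obtain ⟨n, rfl⟩ : ∃ n, N = n + 1 := ⟨N - 1, by omega⟩
  exact ha n (by omega)

end Summit.AtomisticToContinuum.BoseEinsteinCondensation.Theorems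

end
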